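import Literature.Claims.NS.Jennings2020
import HarnessLib

/-!
# D-0090 NS-claims sweep, row C20 `Jennings2020` — refuter's kernel file

Kill against the typed skeleton `Literature.Claims.NS.Jennings2020` (p469733, typist-6;
arXiv:2002.08270 v6, page locators of the skeleton):

* `not_Step6b_JDilation` — the operator-level identity used in the displayed computation
  (9.5)–(9.7), p. 110 (proof of the scaling rule L9.1 (9.4), p. 109): «the fixed-scale mollifier
  `J_γ` commutes with the dilation `v ↦ (x ↦ α v(xα))`», typed as
  `Jmol γ (fun x => α • v (α • x)) = fun x => α • Jmol γ v (α • x)` for all `γ > 0`, `α > 0` and all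
  smooth `v` with every derivative in `L²`. It is false: take `γ = 1`, `α = 4` and
  `v(x) = φ(x) • e₀` with `φ` a smooth bump equal to `1` on the closed unit ball and to `0` outside
  the ball of radius `2`. At `x = 0` the right-hand side is `4 • e₀` (the normalised mollifier `m†`
  has mass one and lives on the unit ball, where `φ = 1`), while the left-hand side is
  `(4 ∫ m†(y) φ(−4y) dy) • e₀` with `∫ m†(y) φ(−4y) dy < 1`, because `φ(−4y) = 0` and `m†(y) > 0`
  on the shell `5/8 < ‖y‖ < 7/8`. (A change of variables shows in general
  `J_γ[x ↦ α v(xα)](x) = α (J_{γα} v)(xα)`: the dilation conjugates the mollification scale, which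
  the display keeps fixed.)

Class (D-0090 vocabulary): false lemma (countermodel). The u-level scaling rule `Step6_ScalingRule`
(L9.1 (9.4) with the SAME `γ` on both sides) and the load-bearing sup bound `Step7_SupBound_911`
((9.11), p. 111–112, obtained from (8.22) through (9.4) and `α → ∞`) are not attacked here: a
countermodel to them needs an explicit solution of the mollified–projected system (7.1).

WHAT THIS IS NOT: not a claim about NS regularity or blow-up; not a claim about any author beyond
the typed locator.
-/

set_option linter.dupNamespace false

open MeasureTheory Set Filter Topology Metric
open scoped ENNReal ContDiff
open Literature.Claims.NS.Jennings2020

namespace Summit.NavierStokesRegularity.NavierStokesRegularity.Theorems.Jennings2020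

noncomputable section

/-! ## The skeleton's mollifier `m†`: sign, support, mass -/

/-- `m† ≥ 0` before normalisation. -/
theorem bump_nonneg (y : E3) : 0 ≤ bump y := by
  unfold bump
  split_ifs
  · exact (Real.exp_pos _).le
  · exact le_rfl

/-- `m† > 0` on the open unit ball. -/
theorem bump_pos {y : E3} (hy : ‖y‖ < 1) : 0 < bump y := by
  unfold bump
  rw [if_pos hy]
  exact Real.exp_pos _

/-- `m† ≤ 1` (the exponent `1/(‖y‖² − 1)` is negative on the unit ball). -/
theorem bump_le_one (y : E3) : bump y ≤ 1 := by
  unfold bump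
  split_ifs with hy
  · have h1 : ‖y‖ ^ 2 < 1 := by
      have h0 : 0 ≤ ‖y‖ := norm_nonneg y
      nlinarith
    have h2 : 1 / (‖y‖ ^ 2 - 1) ≤ 0 := div_nonpos_of_nonneg_of_nonpos zero_le_one (by linarith)
    exact Real.exp_le_one_iff.mpr h2
  · exact zero_le_one

/-- `m†` is the indicator of the unit ball applied to `y ↦ exp (1/(‖y‖² − 1))`. -/
theorem bump_eq_indicator :
    bump = (ball (0 : E3) 1).indicator fun y => Real.exp (1 / (‖y‖ ^ 2 - 1)) := by
  funext y
  simp only [bump, Set.indicator, mem_ball_zero_iff]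

/-- `y ↦ exp (1/(‖y‖² − 1))` is measurable. -/
theorem measurable_expProfile : Measurable fun y : E3 => Real.exp (1 / (‖y‖ ^ 2 - 1)) :=
  Real.measurable_exp.comp ((measurable_const.div ((measurable_norm.pow_const 2).sub
    measurable_const)))

/-- `m†` is integrable (bounded by `1`, supported in the unit ball). -/
theorem integrable_jBump : Integrable Literature.Claims.NS.Jennings2020.bump := by
  rw [bump_eq_indicator, integrable_indicator_iff measurableSet_ball]
  refine Measure.integrableOn_of_bounded (M := 1) measure_ball_lt_top.ne
    measurable_expProfile.aestronglyMeasurable ?_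
  refine (ae_restrict_iff' measurableSet_ball).mpr (ae_of_all _ fun y hy => ?_)
  rw [mem_ball_zero_iff] at hy
  have h1 : ‖y‖ ^ 2 < 1 := by
    have h0 : 0 ≤ ‖y‖ := norm_nonneg y
    nlinarith
  have h2 : 1 / (‖y‖ ^ 2 - 1) ≤ 0 := div_nonpos_of_nonneg_of_nonpos zero_le_one (by linarith)
  rw [Real.norm_eq_abs, abs_of_pos (Real.exp_pos _)]
  exact Real.exp_le_one_iff.mpr h2

/-- The mass `∫ m†` is positive. -/
theorem integral_bump_pos : 0 < ∫ z, bump z := by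
  rw [integral_pos_iff_support_of_nonneg (fun y => bump_nonneg y) integrable_jBump]
  calc (0 : ℝ≥0∞) < volume (ball (0 : E3) 1) := measure_ball_pos _ _ one_pos
    _ ≤ volume (Function.support bump) :=
        measure_mono fun y hy => (bump_pos (mem_ball_zero_iff.mp hy)).ne'

/-- The normalised mollifier is nonnegative. -/
theorem mDag_nonneg (y : E3) : 0 ≤ mDag y :=
  div_nonneg (bump_nonneg y) integral_bump_pos.le

/-- The normalised mollifier is positive on the open unit ball. -/
theorem mDag_pos {y : E3} (hy : ‖y‖ < 1) : 0 < mDag y :=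
  div_pos (bump_pos hy) integral_bump_pos

/-- The normalised mollifier is integrable. -/
theorem integrable_mDag : Integrable mDag :=
  integrable_jBump.div_const _

/-- The normalised mollifier has mass one. -/
theorem integral_mDag : ∫ y, mDag y = 1 := by
  simp only [mDag]
  rw [integral_div, div_self integral_bump_pos.ne']

/-- At scale `γ = 1`, `m†_γ = m†`. -/
theorem mGam_one : mGam 1 = mDag := by
  funext y
  simp [mGam]

/-- `J_1 w (x) = ∫ m†(y) w(x − y) dy`. -/
theorem Jmol_one (w : E3 → E3) : Jmol 1 w = fun x => ∫ y, mDag y • w (x - y) := by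
  funext x
  simp [Jmol, mGam_one]

/-! ## The countermodel field `v = φ • e₀` -/

/-- A smooth bump on `ℝ³`: `1` on the closed unit ball, `0` outside the ball of radius `2`. -/
def phi : ContDiffBump (0 : E3) := ⟨1, 2, one_pos, one_lt_two⟩

/-- `phi.rIn = 1`. -/
theorem phi_rIn : phi.rIn = 1 := rfl

/-- `phi.rOut = 2`. -/
theorem phi_rOut : phi.rOut = 2 := rfl

/-- The first basis vector `e₀` of `ℝ³`. -/
def e0 : E3 := EuclideanSpace.single 0 1

/-- `‖e₀‖ = 1`. -/
theorem norm_e0 : ‖e0‖ = 1 := by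
  simp [e0]

/-- `e₀` has first coordinate `1`. -/
theorem e0_apply_zero : e0 0 = 1 := by
  simp [e0]

/-- The countermodel field `v(x) = φ(x) e₀` (smooth, compactly supported, hence in `∩_m H^m`). -/
def vJ : E3 → E3 := fun x => phi x • e0

/-- `v` is smooth. -/
theorem vJ_contDiff : ContDiff ℝ ((⊤ : ℕ∞) : WithTop ℕ∞) vJ :=
  phi.contDiff.smul contDiff_const

/-- `v` has compact support. -/
theorem vJ_hasCompactSupport : HasCompactSupport vJ :=
  (phi.hasCompactSupport.smul_right (f' := fun _ : E3 => e0))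

/-- Every derivative of `v` is square integrable (continuous with compact support). -/
theorem vJ_isHInf : IsHInf vJ := by
  intro n
  have hc : Continuous (iteratedFDeriv ℝ n vJ) :=
    vJ_contDiff.continuous_iteratedFDeriv (m := n) (by exact_mod_cast le_top)
  have hs : HasCompactSupport (iteratedFDeriv ℝ n vJ) := vJ_hasCompactSupport.iteratedFDeriv n
  have hm : MemLp (iteratedFDeriv ℝ n vJ) 2 volume := hc.memLp_of_hasCompactSupport hs
  have h2 := hm.eLpNorm_lt_top
  rw [eLpNorm_lt_top_iff_lintegral_rpow_enorm_lt_top (by norm_num) (by norm_num)] at h2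
  simpa using h2

/-! ## Both sides of the identity at `x = 0` for `γ = 1`, `α = 4` -/

/-- On the support of `m†`, `φ(0 − y) = 1`; so `m†(y) φ(0 − y) = m†(y)` everywhere. -/
theorem mDag_mul_phi_neg (y : E3) : mDag y * phi (0 - y) = mDag y := by
  by_cases hy : ‖y‖ < 1
  · have h1 : (0 : E3) - y ∈ closedBall (0 : E3) phi.rIn := by
      rw [mem_closedBall, dist_zero_right, phi_rIn, zero_sub, norm_neg]
      exact hy.le
    rw [phi.one_of_mem_closedBall h1, mul_one]
  · have h0 : mDag y = 0 := by
      simp [mDag, bump, hy]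
    rw [h0, zero_mul]

/-- Right-hand side at `0`: `(J_1 v)(0) = e₀`. -/
theorem rhs_at_zero : Jmol 1 vJ 0 = e0 := by
  rw [Jmol_one]
  simp only [vJ]
  have h : (fun y : E3 => mDag y • (phi (0 - y) • e0)) = fun y => mDag y • e0 := by
    funext y
    rw [smul_smul, mDag_mul_phi_neg]
  rw [h, integral_smul_const, integral_mDag, one_smul]

/-- The scalar `s = ∫ m†(y) φ(4(0 − y)) dy` appearing on the left-hand side. -/
def sJ : ℝ := ∫ y, mDag y * phi ((4 : ℝ) • ((0 : E3) - y))

/-- Left-hand side at `0`: `J_1[x ↦ 4 v(4x)](0) = (4 s) • e₀`. -/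
theorem lhs_at_zero :
    Jmol 1 (fun x => (4 : ℝ) • vJ ((4 : ℝ) • x)) 0 = (4 * sJ) • e0 := by
  rw [Jmol_one]
  simp only [vJ]
  have h : (fun y : E3 => mDag y • ((4 : ℝ) • (phi ((4 : ℝ) • ((0 : E3) - y)) • e0))) =
      fun y => ((4 : ℝ) * (mDag y * phi ((4 : ℝ) • ((0 : E3) - y)))) • e0 := by
    funext y
    rw [smul_smul, smul_smul]
    ring_nf
  rw [h, integral_smul_const, integral_const_mul]
  rfl

/-- `y ↦ φ(4(0 − y))` is continuous. -/
theorem continuous_phi_dil : Continuous fun y : E3 => (phi : E3 → ℝ) ((4 : ℝ) • ((0 : E3) - y)) :=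
  phi.continuous.comp
    (((continuous_const.sub continuous_id).const_smul (4 : ℝ)) :
      Continuous fun y : E3 => (4 : ℝ) • ((0 : E3) - y))

/-- The integrand of `s` is integrable (`m†` integrable, `φ ∘ (affine)` continuous and bounded). -/
theorem integrable_sJ : Integrable fun y : E3 => mDag y * phi ((4 : ℝ) • ((0 : E3) - y)) := by
  have hb : ∀ᵐ y : E3 ∂volume, ‖(phi : E3 → ℝ) ((4 : ℝ) • ((0 : E3) - y))‖ ≤ 1 :=
    ae_of_all _ fun y => by
      rw [Real.norm_eq_abs, abs_of_nonneg phi.nonneg]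
      exact phi.le_one
  exact Integrable.mul_bdd (f := mDag)
    (g := fun y : E3 => (phi : E3 → ℝ) ((4 : ℝ) • ((0 : E3) - y))) (c := 1) integrable_mDag
    continuous_phi_dil.aestronglyMeasurable hb

/-- The key strict inequality: `s < 1` (mass of `m†` on the shell `5/8 < ‖y‖ < 7/8` is lost). -/
theorem sJ_lt_one : sJ < 1 := by
  have hnn : 0 ≤ fun y : E3 => mDag y - mDag y * phi ((4 : ℝ) • ((0 : E3) - y)) := by
    intro y
    simp only [Pi.zero_apply]
    have h1 := mDag_nonneg y
    have h2 : phi ((4 : ℝ) • ((0 : E3) - y)) ≤ 1 := phi.le_one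
    nlinarith
  have key : 0 < ∫ y, (mDag y - mDag y * phi ((4 : ℝ) • ((0 : E3) - y))) := by
    rw [integral_pos_iff_support_of_nonneg hnn (integrable_mDag.sub integrable_sJ)]
    have y0n : ‖((3 / 4 : ℝ) • e0 : E3)‖ = 3 / 4 := by
      rw [norm_smul, norm_e0, mul_one, Real.norm_eq_abs, abs_of_pos (by norm_num)]
    calc (0 : ℝ≥0∞) < volume (ball ((3 / 4 : ℝ) • e0 : E3) (1 / 8)) :=
          measure_ball_pos _ _ (by norm_num)
      _ ≤ volume (Function.support fun y : E3 =>
            mDag y - mDag y * phi ((4 : ℝ) • ((0 : E3) - y))) := by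
          refine measure_mono fun y hy => ?_
          rw [mem_ball, dist_eq_norm] at hy
          have hup : ‖y‖ < 7 / 8 := by
            have := norm_le_norm_add_norm_sub' y ((3 / 4 : ℝ) • e0)
            linarith
          have hlo : 5 / 8 < ‖y‖ := by
            have := norm_sub_norm_le ((3 / 4 : ℝ) • e0 : E3) y
            rw [norm_sub_rev] at this
            linarith
          have hphi : phi ((4 : ℝ) • ((0 : E3) - y)) = 0 := by
            refine phi.zero_of_le_dist ?_
            rw [dist_zero_right, phi_rOut, norm_smul, zero_sub, norm_neg, Real.norm_eq_abs,
              abs_of_pos (by norm_num : (0 : ℝ) < 4)]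
            linarith
          rw [Function.mem_support, hphi, mul_zero, sub_zero]
          exact (mDag_pos (by linarith)).ne'
  rw [integral_sub integrable_mDag integrable_sJ, integral_mDag] at key
  unfold sJ
  linarith

/-! ## The refutation -/

/-- **C20 kill.** The fixed-scale mollifier does not commute with dilation:
`Step6b_JDilation` ((9.5)–(9.7), p. 110 of arXiv:2002.08270 v6) fails at `γ = 1`, `α = 4`,
`v = φ • e₀`, `x = 0`. Class: false lemma (countermodel). -/
theorem not_Step6b_JDilation : ¬ Literature.Claims.NS.Jennings2020.Step6b_JDilation := by
  intro h
  have hfun := h 1 one_pos 4 (by norm_num) vJ vJ_contDiff vJ_isHInf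
  have h0 := congrFun hfun 0
  simp only [smul_zero] at h0
  rw [lhs_at_zero, rhs_at_zero] at h0
  have h1 := congrArg (fun w : E3 => w 0) h0
  simp only [PiLp.smul_apply, smul_eq_mul, e0_apply_zero, mul_one] at h1
  have h2 := sJ_lt_one
  linarith

end

end Summit.NavierStokesRegularity.NavierStokesRegularity.Theorems.Jennings2020
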